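import Literature.NumberTheory.DiophantineGeometry.GenEllDeCriticalLocusFamily
import Mathlib.RingTheory.Derivation.Basic

/-!
# The ramification function `N_c` IS the numerator of `dt_c/dr` on `D_e` (GenEllTwo, support piece W5c)

`GenEllDeCriticalLocusFamily.lean` (abc-iut-w5-d059, p415816) DEFINES the ramification function of the
family member `t_c = 1/r + c·r^{k+1}/s` (`s = 1 − 2x`) on the curve `D_e : r^{2k+1} = x(1 − x)` by fiat as
`NvalC k c (x, r) := −s³ + c·α(r)`, `α(r) = (k+1)r^{k+2} − 2r^{3k+3}`, quoting its docstring
«`N_c = r²s³·dt_c/dr`; its zeros on the affine curve are exactly the ramification points of `t_c`»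
([GenEll] Thm 2.1 proof p.12 [cite: MochizukiGenEll2010]); everything downstream (the critical locus
`zeroSetC_eq`, its finiteness and Galois stability) is about the zero set of `NvalC`.  This proof-only file
makes the quoted calculus step KERNEL-VISIBLE, for an arbitrary DERIVATION `D` of a field `K` containing the
coordinates (e.g. `D = d/dr` on the function field of `D_e`, for which `D r = 1`):

* `DeCrit.derivation_curve` — differentiating the curve relation: `(2k+1)·r^{2k}·D r = (1 − 2x)·D x`;
* **`DeCrit.derivation_tC`** — for `s ≠ 0`, `r ≠ 0` and `c` a constant of `D` (`D c = 0`, e.g. `c ∈ ℚ`):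
  `r²·s³ · D(1/r + c·r^{k+1}/s) = NvalC k c (x, r) · D r`;
* `DeCrit.derivation_t` — the case `c = 1` of `GenEllDeCriticalLocus.lean` (`Nval`).

Hence on the chart `r·s ≠ 0` (where `r` is a local coordinate, the curve being smooth with `∂/∂x ≠ 0`
there), `dt_c = (NvalC/(r²s³))·dr`, so the zeros of `NvalC` there are exactly the zeros of `dt_c`, i.e. the
ramification points of `t_c`; the file p415816 shows separately that all zeros of `NvalC` on `D_e` lie in
this chart (`tDen_critPointC_ne_zero`).  Pure commutative algebra (Leibniz rule); classical and undisputed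
(abc-iut cell, RQ7 kernel probe of abc-iut-w5-d239 turned into a tree lemma; supports stmt-ABC-19679).
-/

namespace Literature.NumberTheory.DiophantineGeometry.GenEll.DeCrit

variable {K : Type*} [Field K] (D : Derivation ℤ K K)

/-- Differentiating the equation of `D_e`: from `r^{2k+1} = x(1 − x)`, for every derivation `D`,
`(2k+1)·r^{2k}·D r = (1 − 2x)·D x`. [cite: MochizukiGenEll2010, Thm 2.1 proof p.12] -/
theorem derivation_curve (k : ℕ) {x r : K} (h : r ^ (2 * k + 1) = x * (1 - x)) :
    ((2 * k + 1 : ℕ) : K) * r ^ (2 * k) * D r = (1 - 2 * x) * D x := by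
  have hD := congrArg D h
  rw [Derivation.leibniz_pow, Derivation.leibniz, Derivation.map_sub, Derivation.map_one_eq_zero,
    zero_sub] at hD
  simp only [smul_eq_mul, nsmul_eq_mul, Nat.add_sub_cancel] at hD
  linear_combination hD

/-- **`N_c = r²s³·dt_c/dr` on `D_e`.**  For every derivation `D` of a field `K` and every point
`(x, r)` of `D_e : r^{2k+1} = x(1 − x)` with `r ≠ 0`, `s := 1 − 2x ≠ 0`:
`r²·s³·D(1/r + c·r^{k+1}/s) = NvalC k c (x, r) · D r`.  (With `D = d/dr`, `D r = 1`: the ramification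
function of p415816 is the numerator of `dt_c/dr`.) [cite: MochizukiGenEll2010, Thm 2.1 proof p.12] -/
theorem derivation_tC (k : ℕ) {c x r : K} (hDc : D c = 0) (h : r ^ (2 * k + 1) = x * (1 - x))
    (hr : r ≠ 0) (hs : (1 - 2 * x) ≠ 0) :
    r ^ 2 * (1 - 2 * x) ^ 3 * D (1 / r + c * r ^ (k + 1) / (1 - 2 * x)) = NvalC k c (x, r) * D r := by
  have hder := derivation_curve D k h
  have h2 : D (2 : K) = 0 := by simpa using D.map_natCast 2
  -- expand `D` by the Leibniz rules (`c`, `1`, `2` are constants for `D`)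
  have hexp : D (1 / r + c * r ^ (k + 1) / (1 - 2 * x)) =
      -(D r) / r ^ 2 + c * ((k + 1 : ℕ) : K) * r ^ k * D r / (1 - 2 * x)
        + 2 * c * r ^ (k + 1) * D x / (1 - 2 * x) ^ 2 := by
    simp only [Derivation.map_add, Derivation.leibniz_div, Derivation.leibniz, Derivation.leibniz_pow,
      Derivation.map_sub, Derivation.map_one_eq_zero, h2, hDc, smul_eq_mul, nsmul_eq_mul,
      Nat.add_sub_cancel, mul_zero, add_zero, zero_sub]
    field_simp
    ring
  rw [hexp, NvalC_eq]
  field_simp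
  push_cast at hder ⊢
  linear_combination (-(2 : K) * c * r ^ (k + 3)) * hder
    + (4 * c * ((k : K) + 1) * r ^ (k + 2) * D r) * h

/-- The case `c = 1`: `r²·s³·D(1/r + r^{k+1}/s) = Nval k (x, r) · D r` — the ramification function of
`GenEllDeCriticalLocus.lean` is the numerator of `dt/dr`. [cite: MochizukiGenEll2010, Thm 2.1 proof p.12] -/
theorem derivation_t (k : ℕ) {x r : K} (h : r ^ (2 * k + 1) = x * (1 - x))
    (hr : r ≠ 0) (hs : (1 - 2 * x) ≠ 0) :
    r ^ 2 * (1 - 2 * x) ^ 3 * D (1 / r + r ^ (k + 1) / (1 - 2 * x)) = Nval k (x, r) * D r := by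
  have := derivation_tC D k (c := (1 : K)) D.map_one_eq_zero h hr hs
  rwa [one_mul, NvalC_one] at this

end Literature.NumberTheory.DiophantineGeometry.GenEll.DeCrit
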